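import Summits.Ventures.PercRepro.RankLevelSetDepCount
import Summits.Ventures.PercRepro.RankLevelSetLevelFourArith
import Summits.Ventures.PercRepro.RankLevelSetPlaneTen
import Summits.Ventures.PercRepro.RankLevelSetCoreFour
import Summits.Ventures.PercRepro.RankLevelSetFrameLarge
import Summits.Ventures.PercRepro.RankLevelSetFrameQM

/-!
# PercRepro — THEOREM C₄: C-025 AT LEVEL `4` FOR EVERY FINITE MATROID AND EVERY `p ≥ 60`, GIVEN LEVEL `3`
(night-1, gen 4)

`proofs/NIGHT-1-C025-induction.md` §15. Theorem C∞ (`RankLevelSetFrameLarge`) gives level `4` for all `p ≥ P(4)` with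
`P(4)` EXISTENTIAL, because the bounded-corank half of its wrapper is Theorem C (existential). Here the threshold is
EXPLICIT: `P(4) ≤ 60`.

* **`c025_core_four_bounded_corank`** — the `e`-free core (rank `p ≥ 59`, every element with an `e`-free partition,
  coloops allowed) at corank `5 ≤ d ≤ 15`: `#U ≤ C(n, 4) + σ(d)·(s₃·C(n, 2) + s₄·n + s₅)` with the circuit counts
  `s_k ≤ C(d + k − 1, k)` (`RankLevelSetCircuitCount`, `RankLevelSetDepCount`), `#Y ≥ 2^n − Σ_{j≤10} C(n, j) −
  Σ_{j≤d} C(n, j)` (rank-`≤ 4` sets have `≤ 10` points on the core, `RankLevelSetPlaneTen`; spanning sets have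
  coindependent complements), `Φ(p, 4) ≤ 2^{p+4}/C(p+4, 4)`, and the polynomial inequalities `(P_d)` of
  `RankLevelSetLevelFourArith`;
* **`c025_four_of_three`** — THEOREM C₄ given level `3`: the wrapper `rls_succ_large 3 4 59` needs level `4` only at
  corank `≤ 4` outside the core (`U = ∅` below corank `4`, Theorem M at corank `4`: `RLS_of_ncard_lt`,
  `RLS_of_ncard_eq`), and on the core coranks `5 … 15` are `c025_core_four_bounded_corank` and coranks `≥ 16` are
  `c025_core_four_ten` (`RankLevelSetCoreFour`, `p ≥ 32`). Hence: level `3` for all `p ≥ 5` implies level `4` for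
  every finite matroid and every `p ≥ 60`. With the q = 3 row (`c025_three_all`) the statement is unconditional
  (`RankLevelSetLevelFourAll`).
Axioms: standard.
-/

open scoped Matroid

namespace PercRepro

namespace ThmN

open Set

variable {α : Type}

/-- **The `e`-free core at level `4`, corank `5 ≤ d ≤ 15`, rank `p ≥ 59`.** -/
theorem c025_core_four_bounded_corank (M : Matroid α) [M.Finite] (p d : ℕ) (hp : 59 ≤ p) (hd5 : 5 ≤ d)
    (hd15 : d ≤ 15) (hR : M.eRank = (p : ℕ∞)) (hn : M.E.ncard = p + d)
    (hfree : ∀ e ∈ M.E, ∃ A ⊆ M.E \ {e}, e ∉ M.closure A ∧ e ∉ M.closure ((M.E \ {e}) \ A)) :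
    RLS M p 4 := by
  classical
  have hEcard : M.ground_finite.toFinset.card = p + d := by
    rw [← Set.ncard_eq_toFinset_card _ M.ground_finite]; exact hn
  -- the core is simple: every circuit has `≥ 3` elements
  have hL : ∀ e ∈ M.E, ¬ M.IsLoop e := not_isLoop_of_free M hfree
  have hs : ∀ e ∈ M.E, ∀ f ∈ M.E, e ≠ f → M.eRk {e, f} = 2 := by
    intro e he f hf hef
    have h2 : (2 : ℕ∞) ≤ M.eRk {e, f} :=
      two_le_eRk_of_two_le_ncard_of_free M hfree (pair_subset he hf) (by rw [ncard_pair hef])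
    have h3 : M.eRk {e, f} ≤ 2 := by
      have := M.eRk_le_encard {e, f}
      rwa [encard_pair hef] at this
    exact le_antisymm h3 h2
  have hcirc : ∀ C, M.IsCircuit C → 3 ≤ C.encard := three_le_encard_of_circuit M hL hs
  -- rank-`≤ 4` sets have `≤ 10` points
  have hten : ∀ X ⊆ M.E, M.eRk X ≤ 4 → X.ncard ≤ 10 :=
    fun X hX hr => ncard_le_ten_of_eRk_le_four_of_free M hfree hX hr
  have hd : M.E.encard = M.eRank + d := by
    rw [hR, ← M.ground_finite.cast_ncard_eq, hn]
    push_cast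
    ring
  -- (U)
  have hU1 := Matroid.topCount_le_ncard_compl (M := M) hR hd 4
  have hU2 := Matroid.ncard_eRk_eq_four_ncard_le_le M hcirc hten d
  have hs3 : {C | M.IsCircuit C ∧ C.ncard = 3}.ncard ≤ (d + 2).choose 3 :=
    Matroid.ncard_circuits_le_choose_of_encard M hd 2
  have hs4 : {C | M.IsCircuit C ∧ C.ncard = 4}.ncard ≤ (d + 3).choose 4 :=
    Matroid.ncard_circuits_le_choose_of_encard M hd 3
  have hs5 : {C | M.IsCircuit C ∧ C.ncard = 5}.ncard ≤ (d + 4).choose 5 :=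
    Matroid.ncard_circuits_le_choose_of_encard M hd 4
  rw [hn] at hU2
  have hU : Matroid.topCount M p 4 ≤ (p + d).choose 4 +
      (∑ j ∈ Finset.range (d - 5 + 1), Nat.choose 5 j) *
        ((d + 2).choose 3 * (p + d).choose 2 + (d + 3).choose 4 * (p + d) + (d + 4).choose 5) := by
    refine hU1.trans (hU2.trans ?_)
    gcongr
  -- (Y)
  have hY := Matroid.two_pow_le_midCount_add (M := M) p 4 hR
  have hA : {X : Set α | X ⊆ M.E ∧ M.eRk X ≤ 4}.ncard ≤ ∑ j ∈ Finset.range (10 + 1), (p + d).choose j := by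
    calc {X : Set α | X ⊆ M.E ∧ M.eRk X ≤ 4}.ncard
        ≤ {X : Set α | X ⊆ (M.ground_finite.toFinset : Set α) ∧ X.ncard ≤ 10}.ncard := by
          apply ncard_le_ncard
          · intro X hX
            exact ⟨by rw [Set.Finite.coe_toFinset]; exact hX.1, hten X hX.1 hX.2⟩
          · exact (Finset.finite_toSet _).finite_subsets.subset (fun X hX => hX.1)
      _ ≤ ∑ j ∈ Finset.range (10 + 1), M.ground_finite.toFinset.card.choose j :=
          ncard_subsets_ncard_le _ 10
      _ = ∑ j ∈ Finset.range (10 + 1), (p + d).choose j := by rw [hEcard]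
  have hB := Matroid.ncard_spanning_le (M := M) hd
  rw [hEcard] at hY hB
  -- the tails
  have hT : 16 * ∑ j ∈ Finset.range 16, (p + d).choose j ≤ 2 ^ (p + d) :=
    sixteen_mul_sum_choose_le (p + d) (by omega)
  have hA' : ∑ j ∈ Finset.range (10 + 1), (p + d).choose j ≤ ∑ j ∈ Finset.range 16, (p + d).choose j :=
    Finset.sum_le_sum_of_subset_of_nonneg (Finset.range_mono (by norm_num)) (fun _ _ _ => Nat.zero_le _)
  have hB' : ∑ j ∈ Finset.range (d + 1), (p + d).choose j ≤ ∑ j ∈ Finset.range 16, (p + d).choose j :=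
    Finset.sum_le_sum_of_subset_of_nonneg (Finset.range_mono (by omega)) (fun _ _ _ => Nat.zero_le _)
  have hAB : 8 * ({X : Set α | X ⊆ M.E ∧ M.eRk X ≤ 4}.ncard +
      {X : Set α | X ⊆ M.E ∧ M.eRk X = M.eRank}.ncard) ≤ 2 ^ (p + d) := by
    have h1 := hA.trans hA'
    have h2 := hB.trans hB'
    omega
  -- (Φ) and the polynomial inequality
  have hΦ := phiK_le_two_pow_div p 4
  rw [Nat.choose_symm_add] at hΦ
  have hpoly := level_four_poly d hd5 hd15 p hp
  -- assemble in `ℚ`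
  rw [RLS_iff]
  have hUq : (Matroid.topCount M p 4 : ℚ) ≤ ((p + d).choose 4 : ℚ) +
      (((∑ j ∈ Finset.range (d - 5 + 1), Nat.choose 5 j) *
        ((d + 2).choose 3 * (p + d).choose 2 + (d + 3).choose 4 * (p + d) + (d + 4).choose 5) : ℕ) : ℚ) := by
    exact_mod_cast hU
  have hYq : (2 : ℚ) ^ (p + d) ≤ (Matroid.midCount M p 4 : ℚ) +
      ({X : Set α | X ⊆ M.E ∧ M.eRk X ≤ 4}.ncard : ℚ) +
      ({X : Set α | X ⊆ M.E ∧ M.eRk X = M.eRank}.ncard : ℚ) := by exact_mod_cast hY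
  have hABq : 8 * (({X : Set α | X ⊆ M.E ∧ M.eRk X ≤ 4}.ncard : ℚ) +
      ({X : Set α | X ⊆ M.E ∧ M.eRk X = M.eRank}.ncard : ℚ)) ≤ 2 ^ (p + d) := by exact_mod_cast hAB
  have hpolyq : 8 * (((p + d).choose 4 : ℚ) +
      (((∑ j ∈ Finset.range (d - 5 + 1), Nat.choose 5 j) *
        ((d + 2).choose 3 * (p + d).choose 2 + (d + 3).choose 4 * (p + d) + (d + 4).choose 5) : ℕ) : ℚ)) ≤
      7 * 2 ^ (d - 4) * ((p + 4).choose 4 : ℚ) := by exact_mod_cast hpoly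
  have hU0 : (0 : ℚ) ≤ (Matroid.topCount M p 4 : ℚ) := Nat.cast_nonneg _
  have hd4 : 4 ≤ d := by omega
  exact level_four_arith (p := p) (d := d) (n := p + d) rfl hd4 hΦ hU0 hUq hYq hABq hpolyq

/-- **THEOREM C₄, GIVEN LEVEL `3`**: if every finite matroid satisfies C-025 at level `3` for all `p ≥ 5`, then every
finite matroid satisfies C-025 at level `4` for all `p ≥ 60` — `Φ(p, 4)·#U(p, 4) ≤ #Y(p, 4)` with NO corank
restriction and an EXPLICIT threshold. -/
theorem c025_four_of_three (h3 : ∀ (M : Matroid α) [M.Finite] (p : ℕ), 5 ≤ p → RLS M p 3) :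
    ∀ (M : Matroid α) [M.Finite] (p : ℕ), 60 ≤ p → RLS M p 4 := by
  intro M _ p hp
  refine rls_succ_large (α := α) 3 4 59 ?_ ?_ ?_ M p hp (by omega)
  · -- level `3` for `p ≥ 59`
    intro M' _ p' _ hp'
    exact h3 M' p' (by omega)
  · -- corank `≤ 4`: `U = ∅` or Theorem M
    intro M' _ p' _ hn _
    rcases Nat.lt_or_ge M'.E.ncard (p' + 4) with h | h
    · exact RLS_of_ncard_lt M' h
    · exact RLS_of_ncard_eq M' (by omega)
  · -- the core: coranks `5 … 15` by counting, coranks `≥ 16` by `c025_core_four_ten`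
    intro M' _ p' hP hR hbig _ hfree
    rcases Nat.lt_or_ge M'.E.ncard (p' + 16) with h | h
    · exact c025_core_four_bounded_corank M' p' (M'.E.ncard - p') hP (by omega) (by omega) hR (by omega) hfree
    · exact c025_core_four_ten M' p' (by omega) hR (by omega) hfree

end ThmN

end PercRepro
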